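import Summits.CriticalPhenomena.SAWScalingLimit.Theorems.SAWTotalPositivityTPToTraversalBoundRadialDefs
import Literature.Probability.LatticeModels.MedialExplorationChains

/-!
# Radial chain for `TPToTraversalBound`, part II-a: maximal outside pieces and the mesh polyline

Crux `SAWTotalPositivity.TPToTraversalBound` (stmt-CriticalPhenomena-10687), line `radial-portal-transfer`,
stub `stub_chain` (bookkeeping: heaviness contraction + top state ⇒ (H1) on interior shells).

Combinatorics of the vocabulary of `…RadialDefs`: the outside configuration `outEdgeSet` refines
as the box shrinks (`outEdgeSet_eq_of_le`, the filtration of the chain); the heaviness as a number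
(`hasPieces_iff_le_findGreatest`); every outside index lies in a maximal outside piece
(`exists_isOutsidePiece`) and overlapping maximal pieces coincide; the registered sub-goal
`stub_chain_stretch`: a stretch of one SAW made of edges of another SAW visits the latter
monotonically (discrete intermediate values); and where the mesh polyline of a walk is at time `t`
(`toCurve_mem_segment`, via `pieceIdx` of `MedialExplorationChains`; `dist_toCurve_getVert_le`).
-/

noncomputable section

open MeasureTheory Filter Topology Set Metric
open scoped NNReal ENNReal unitInterval
open Literature.Probability.LatticeModels
open Literature.Probability.RandomPlanarGeometry
open Literature.Probability.RandomPlanarGeometry.SAW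
open Summit.CriticalPhenomena.SAWScalingLimit.Theses.SAWTotalPositivity

namespace Summit.CriticalPhenomena.SAWScalingLimit.Theorems.TPToTraversalBound.Radial

variable {Ω : Set ℂ} {δ : ℝ} {u v : Site 2}

/-! ## Lattice steps -/

/-- Adjacent sites of `Ω_δ` are nearest neighbours of `ℤ²`, hence at sup-distance `≤ 1`.
[folklore] -/
theorem supDist_le_one_of_adj {p q : Site 2} (h : (discreteDomainGraph Ω δ).Adj p q) :
    supDist p q ≤ 1 := by
  have hz : (zdGraph 2).Adj p q :=
    meshGraph_le_zdGraph Ω δ (discreteDomainGraph_le_meshGraph Ω δ h)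
  obtain ⟨i, hi | hi⟩ := (zdGraph_adj_iff p q).1 hz
  · rw [hi]
    refine max_le ?_ ?_ <;>
    · simp only [Pi.add_apply, Pi.single_apply]
      split_ifs <;> simp
  · rw [hi]
    refine max_le ?_ ?_ <;>
    · simp only [Pi.add_apply, Pi.single_apply]
      split_ifs <;> simp

/-- Consecutive vertices of a SAW are at sup-distance `≤ 1`. [folklore] -/
theorem supDist_getVert_succ_le (γ : DomainSAW Ω δ u v) {t : ℕ} (ht : t < γ.walk.length) :
    supDist (γ.walk.getVert t) (γ.walk.getVert (t + 1)) ≤ 1 :=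
  supDist_le_one_of_adj (γ.walk.adj_getVert_succ ht)

/-! ## Edges of a walk by index -/

/-- The edges of a walk are the pairs of consecutive vertices. [folklore] -/
theorem mem_edges_iff_getVert {V : Type*} {G : SimpleGraph V} {a b : V} (p : G.Walk a b)
    (e : Sym2 V) : e ∈ p.edges ↔ ∃ n, n < p.length ∧ e = s(p.getVert n, p.getVert (n + 1)) := by
  rw [SimpleGraph.Walk.edges, List.mem_map]
  constructor
  · rintro ⟨d, hd, rfl⟩
    obtain ⟨n, hn, rfl⟩ := List.mem_iff_getElem.1 hd
    refine ⟨n, by simpa using hn, ?_⟩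
    rw [SimpleGraph.Walk.darts_getElem_eq_getVert n hn]
    rfl
  · rintro ⟨n, hn, rfl⟩
    have hn' : n < p.darts.length := by simpa using hn
    refine ⟨p.darts[n], List.getElem_mem hn', ?_⟩
    rw [SimpleGraph.Walk.darts_getElem_eq_getVert n hn']
    rfl

/-- The `t`-th edge of a SAW is an edge of it. [folklore] -/
theorem mk_getVert_mem_edges (γ : DomainSAW Ω δ u v) {t : ℕ} (ht : t < γ.walk.length) :
    s(γ.walk.getVert t, γ.walk.getVert (t + 1)) ∈ γ.walk.edges :=
  (mem_edges_iff_getVert γ.walk _).2 ⟨t, ht, rfl⟩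

/-! ## The outside configuration refines as the box shrinks -/

/-- A smaller box has a bigger open-box complement: the outside configuration of the box of
half-side `N ≥ N'` is read off from that of the box `N'`. [folklore] -/
theorem outEdgeSet_eq_sep (γ : DomainSAW Ω δ u v) (c : Site 2) {N N' : ℕ} (h : N' ≤ N) :
    outEdgeSet γ c N = {e ∈ outEdgeSet γ c N' | ∀ w ∈ e, ¬ InOpenBox c N w} := by
  ext e
  simp only [outEdgeSet, Set.mem_setOf_eq]
  constructor
  · rintro ⟨he, hout⟩
    refine ⟨⟨he, fun w hw hin => hout w hw ?_⟩, hout⟩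
    exact lt_of_lt_of_le hin (by exact_mod_cast h)
  · rintro ⟨⟨he, -⟩, hout⟩
    exact ⟨he, hout⟩

/-- **Filtration.** Two SAWs with the same outside configuration for the box `N'` have the same
outside configuration for every bigger box `N ≥ N'`. [folklore] -/
theorem outEdgeSet_eq_of_le {γ γ' : DomainSAW Ω δ u v} (c : Site 2) {N N' : ℕ} (h : N' ≤ N)
    (heq : outEdgeSet γ c N' = outEdgeSet γ' c N') : outEdgeSet γ c N = outEdgeSet γ' c N := by
  rw [outEdgeSet_eq_sep γ c h, outEdgeSet_eq_sep γ' c h, heq]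

/-! ## Heaviness as a number -/

/-- At most `|γ| + 1` pieces (their starting indices are distinct and `≤ |γ|`). [folklore] -/
theorem HasPieces.le_length_succ {γ : DomainSAW Ω δ u v} {c : Site 2} {N d m : ℕ}
    (h : HasPieces γ c N d m) : m ≤ γ.walk.length + 1 := by
  obtain ⟨i, j, hi, hk⟩ := h
  have hmaps : ∀ k ∈ (Finset.univ : Finset (Fin m)), i k ∈ Finset.range (γ.walk.length + 1) :=
    fun k _ => Finset.mem_range.2 (Nat.lt_succ_of_le ((hk k).1.1.trans (hk k).1.2.1))
  have := Finset.card_le_card_of_injOn i hmaps hi.injective.injOn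
  simpa using this

open Classical in
/-- The HEAVINESS `h = max {m | HasPieces γ c N d m}` (number of maximal outside pieces of
sup-diameter `≥ d/2`) is `Nat.findGreatest` below the a-priori bound `|γ| + 1`, and
`HasPieces γ c N d m ↔ m ≤ h`. [cite: AizenmanBurchard1999, §1.b] -/
theorem hasPieces_iff_le_findGreatest {γ : DomainSAW Ω δ u v} {c : Site 2} {N d m : ℕ} :
    HasPieces γ c N d m ↔ m ≤ Nat.findGreatest (HasPieces γ c N d) (γ.walk.length + 1) := by
  constructor
  · intro h
    exact Nat.le_findGreatest h.le_length_succ h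
  · intro h
    exact (Nat.findGreatest_spec (P := HasPieces γ c N d) (Nat.zero_le _)
      (hasPieces_zero γ c N d)).of_le h

/-! ## Maximal outside pieces -/

/-- Every index of the walk at which it is outside the open box lies in a maximal outside piece.
[folklore] -/
theorem exists_isOutsidePiece (γ : DomainSAW Ω δ u v) (c : Site 2) (N : ℕ) {q : ℕ}
    (hq : q ≤ γ.walk.length) (hout : ¬ InOpenBox c N (γ.walk.getVert q)) :
    ∃ i j, i ≤ q ∧ q ≤ j ∧ IsOutsidePiece γ c N i j := by
  classical
  -- the right end
  set P : ℕ → Prop := fun j => q ≤ j ∧ j ≤ γ.walk.length ∧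
    ∀ t, q ≤ t → t ≤ j → ¬ InOpenBox c N (γ.walk.getVert t) with hP
  have hPq : P q := ⟨le_rfl, hq, fun t h1 h2 => by rwa [le_antisymm h2 h1]⟩
  set j₀ := Nat.findGreatest P γ.walk.length with hj₀
  have hPj : P j₀ := Nat.findGreatest_spec hq hPq
  have hjmax : j₀ = γ.walk.length ∨ InOpenBox c N (γ.walk.getVert (j₀ + 1)) := by
    rcases (Nat.findGreatest_le (P := P) γ.walk.length).lt_or_eq with hlt | heq
    · right
      by_contra hin
      refine Nat.findGreatest_is_greatest (P := P) (Nat.lt_succ_self j₀) (Nat.succ_le_of_lt hlt)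
        ⟨hPj.1.trans (Nat.le_succ _), Nat.succ_le_of_lt hlt, fun t h1 h2 => ?_⟩
      rcases (Nat.le_succ_iff.1 h2) with h | rfl
      · exact hPj.2.2 t h1 h
      · exact hin
    · exact Or.inl heq
  -- the left end
  set Q : ℕ → Prop := fun i => i ≤ q ∧ ∀ t, i ≤ t → t ≤ q → ¬ InOpenBox c N (γ.walk.getVert t)
    with hQ
  have hQq : ∃ i, Q i := ⟨q, le_rfl, fun t h1 h2 => by rwa [le_antisymm h2 h1]⟩
  set i₀ := Nat.find hQq with hi₀
  have hQi : Q i₀ := Nat.find_spec hQq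
  have himin : i₀ = 0 ∨ InOpenBox c N (γ.walk.getVert (i₀ - 1)) := by
    rcases Nat.eq_zero_or_pos i₀ with h0 | hpos
    · exact Or.inl h0
    · right
      by_contra hin
      have hQ' : Q (i₀ - 1) := ⟨(Nat.sub_le _ _).trans hQi.1, fun t h1 h2 => ?_⟩
      · exact Nat.find_min hQq (Nat.sub_lt hpos Nat.one_pos) hQ'
      rcases (Nat.lt_or_eq_of_le h1) with h | rfl
      · exact hQi.2 t (by omega) h2
      · exact hin
  refine ⟨i₀, j₀, hQi.1, hPj.1, hQi.1.trans hPj.1, hPj.2.1, fun t h1 h2 => ?_, himin, hjmax⟩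
  rcases le_total t q with h | h
  · exact hQi.2 t h1 h
  · exact hPj.2.2 t h h2

/-- Two maximal outside pieces sharing an index coincide. [folklore] -/
theorem IsOutsidePiece.eq_of_mem {γ : DomainSAW Ω δ u v} {c : Site 2} {N i₁ j₁ i₂ j₂ q : ℕ}
    (h₁ : IsOutsidePiece γ c N i₁ j₁) (h₂ : IsOutsidePiece γ c N i₂ j₂)
    (hq₁ : i₁ ≤ q ∧ q ≤ j₁) (hq₂ : i₂ ≤ q ∧ q ≤ j₂) : i₁ = i₂ ∧ j₁ = j₂ := by
  obtain ⟨-, hj₁, hout₁, hl₁, hr₁⟩ := h₁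
  obtain ⟨-, hj₂, hout₂, hl₂, hr₂⟩ := h₂
  constructor
  · by_contra hne
    rcases Nat.lt_or_gt_of_ne hne with hlt | hlt
    · rcases hl₂ with h0 | hin
      · omega
      · exact hout₁ (i₂ - 1) (by omega) (by omega) hin
    · rcases hl₁ with h0 | hin
      · omega
      · exact hout₂ (i₁ - 1) (by omega) (by omega) hin
  · by_contra hne
    rcases Nat.lt_or_gt_of_ne hne with hlt | hlt
    · rcases hr₁ with h0 | hin
      · omega
      · exact hout₂ (j₁ + 1) (by omega) (by omega) hin
    · rcases hr₂ with h0 | hin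
      · omega
      · exact hout₁ (j₂ + 1) (by omega) (by omega) hin

/-! ## Discrete intermediate values along shared edges -/

/-- Discrete intermediate value property of a `±1`-Lipschitz integer sequence. [folklore] -/
theorem nat_ivt (ψ : ℕ → ℕ) (a : ℕ) :
    ∀ b, a ≤ b → (∀ s, a ≤ s → s < b → ψ (s + 1) ≤ ψ s + 1 ∧ ψ s ≤ ψ (s + 1) + 1) →
      ∀ r, min (ψ a) (ψ b) ≤ r → r ≤ max (ψ a) (ψ b) → ∃ s, a ≤ s ∧ s ≤ b ∧ ψ s = r := by
  refine Nat.le_induction ?_ ?_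
  · intro _ r h1 h2
    refine ⟨a, le_rfl, le_rfl, ?_⟩
    simp only [min_self, max_self] at h1 h2
    omega
  · intro b hab ih hstep r h1 h2
    have hs := hstep b hab (Nat.lt_succ_self b)
    by_cases hr : min (ψ a) (ψ b) ≤ r ∧ r ≤ max (ψ a) (ψ b)
    · obtain ⟨s, hs1, hs2, hs3⟩ :=
        ih (fun s h h' => hstep s h (h'.trans (Nat.lt_succ_self b))) r hr.1 hr.2
      exact ⟨s, hs1, hs2.trans (Nat.le_succ b), hs3⟩
    · refine ⟨b + 1, Nat.le_succ_of_le hab, le_rfl, ?_⟩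
      omega

/-- **Shared stretches are traversed monotonically** (registered sub-goal `stub_chain_stretch`
of `stub_chain`). If along the index interval `[s₁, s₂]` of the SAW `γ'` every step is an edge
of the SAW `γ`, and the stretch starts at `γ r₁` and ends at `γ r₂`, then it visits `γ r` for
every `r` between `r₁` and `r₂` (the position in `γ` moves by `±1` at each step, since `γ` is
self-avoiding). [folklore] -/
theorem stub_chain_stretch : ∀ {Ω : Set ℂ} {δ : ℝ} {u v u' v' : Site 2}
    (γ' : DomainSAW Ω δ u' v') (γ : DomainSAW Ω δ u v) {s₁ s₂ : ℕ}, s₁ ≤ s₂ →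
    (∀ s, s₁ ≤ s → s < s₂ → s(γ'.walk.getVert s, γ'.walk.getVert (s + 1)) ∈ γ.walk.edges) →
    ∀ {r₁ r₂ : ℕ}, r₁ ≤ γ.walk.length → r₂ ≤ γ.walk.length →
    γ'.walk.getVert s₁ = γ.walk.getVert r₁ → γ'.walk.getVert s₂ = γ.walk.getVert r₂ →
    ∀ {r : ℕ}, min r₁ r₂ ≤ r ∧ r ≤ max r₁ r₂ →
    ∃ s, s₁ ≤ s ∧ s ≤ s₂ ∧ γ'.walk.getVert s = γ.walk.getVert r := by
  intro Ω δ u v u' v' γ' γ s₁ s₂ hs hsteps r₁ r₂ hr₁ hr₂ h₁ h₂ r hr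
  have hinj := γ.isPath.getVert_injOn
  rcases hs.lt_or_eq with hlt | rfl
  swap
  · -- degenerate stretch
    have : r₁ = r₂ := hinj hr₁ hr₂ (h₁.symm.trans h₂)
    subst this
    refine ⟨s₁, le_rfl, le_rfl, ?_⟩
    rw [h₁]
    congr 1
    simp only [min_self, max_self] at hr
    omega
  -- position in `γ` of the vertices of the stretch
  have hmem : ∀ s, s₁ ≤ s → s ≤ s₂ → ∃ n, γ.walk.getVert n = γ'.walk.getVert s ∧ n ≤ γ.walk.length := by
    intro s hs1 hs2
    rcases hs2.lt_or_eq with h | rfl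
    · exact SimpleGraph.Walk.mem_support_iff_exists_getVert.1
        (γ.walk.fst_mem_support_of_mem_edges (hsteps s hs1 h))
    · have h' := hsteps (s - 1) (by omega) (by omega)
      rw [show s - 1 + 1 = s by omega] at h'
      exact SimpleGraph.Walk.mem_support_iff_exists_getVert.1
        (γ.walk.snd_mem_support_of_mem_edges h')
  choose! ψ hψ hψle using hmem
  have hψ₁ : ψ s₁ = r₁ := hinj (hψle s₁ le_rfl hs) hr₁ ((hψ s₁ le_rfl hs).trans h₁)
  have hψ₂ : ψ s₂ = r₂ := hinj (hψle s₂ hs le_rfl) hr₂ ((hψ s₂ hs le_rfl).trans h₂)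
  -- `±1` steps
  have hstep : ∀ s, s₁ ≤ s → s < s₂ → ψ (s + 1) ≤ ψ s + 1 ∧ ψ s ≤ ψ (s + 1) + 1 := by
    intro s h1 h2
    obtain ⟨n, hn, he⟩ := (mem_edges_iff_getVert γ.walk _).1 (hsteps s h1 h2)
    have ha := hψ s h1 h2.le
    have hb := hψ (s + 1) (by omega) (by omega)
    have hla := hψle s h1 h2.le
    have hlb := hψle (s + 1) (by omega) (by omega)
    rcases Sym2.eq_iff.1 he with ⟨e1, e2⟩ | ⟨e1, e2⟩
    · have h3 : ψ s = n := hinj hla (by exact hn.le) (ha.trans e1)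
      have h4 : ψ (s + 1) = n + 1 := hinj hlb (by exact hn) (hb.trans e2)
      omega
    · have h3 : ψ s = n + 1 := hinj hla (by exact hn) (ha.trans e1)
      have h4 : ψ (s + 1) = n := hinj hlb (by exact hn.le) (hb.trans e2)
      omega
  obtain ⟨s, hs1, hs2, hs3⟩ := nat_ivt ψ s₁ s₂ hs hstep r (by rw [hψ₁, hψ₂]; exact hr.1)
    (by rw [hψ₁, hψ₂]; exact hr.2)
  exact ⟨s, hs1, hs2, by rw [← hψ s hs1 hs2, hs3]⟩
/-! ## The polyline of a walk, segment by segment -/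

section Polyline

variable {V E : Type*} [AddCommGroup E] [Module ℝ E] [TopologicalSpace E] [ContinuousAdd E]
  [ContinuousSMul ℝ E] {G : SimpleGraph V}

/-- **Where the polyline of a walk is at time `t`**: in the dyadic `Path.trans` parametrisation
of `polyline`, on the segment between the embedded vertices number `pieceIdx w.support.tail t`
and the next one (clamped at the last vertex by `getVert` on the constant tail).
[cite: CamiaNewman2007, §2] -/
theorem toCurve_mem_segment (emb : V → E) :
    ∀ {a b : V} (w : G.Walk a b) (t : I),
      w.toCurve emb t ∈ segment ℝ (emb (w.getVert (pieceIdx w.support.tail t)))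
        (emb (w.getVert (pieceIdx w.support.tail t + 1)))
  | _, _, .nil, t => by
    simp [SimpleGraph.Walk.toCurve, polyline, pieceIdx]
  | a, _, .cons (v := b) h p, t => by
    have hp : p.toCurve emb = polyline (emb b :: (p.support.tail.map emb)) := by
      unfold SimpleGraph.Walk.toCurve
      rw [← p.cons_tail_support]
      rfl
    have hc : (SimpleGraph.Walk.cons h p).toCurve emb =
        polyline (emb a :: emb b :: (p.support.tail.map emb)) := by
      unfold SimpleGraph.Walk.toCurve
      rw [SimpleGraph.Walk.support_cons, ← p.cons_tail_support]
      rfl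
    have htail : (SimpleGraph.Walk.cons h p).support.tail = b :: p.support.tail := by
      rw [SimpleGraph.Walk.support_cons, List.tail_cons]
      exact (p.cons_tail_support).symm
    rw [hc, htail]
    simp only [polyline, polylineFrom_cons, Path.coe_toContinuousMap]
    rw [Path.trans_apply]
    unfold pieceIdx
    split_ifs with ht
    · simp only [SimpleGraph.Walk.getVert_zero, zero_add, SimpleGraph.Walk.getVert_cons_succ,
        SimpleGraph.Walk.getVert_zero]
      rw [← Path.range_segment (emb a) (emb b)]
      exact Set.mem_range_self _
    · have ih := toCurve_mem_segment emb p
        ⟨2 * t - 1, unitInterval.two_mul_sub_one_mem_iff.2 ⟨(not_le.1 ht).le, t.2.2⟩⟩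
      rw [hp] at ih
      simpa only [SimpleGraph.Walk.getVert_cons_succ, polyline, Path.coe_toContinuousMap] using ih

end Polyline

/-! ## Mesh points and sup-distance -/

/-- Upper bound: mesh points are within `2 δ ·` sup-distance. [folklore] -/
theorem dist_meshPoint_le (hδ : 0 ≤ δ) (p q : Site 2) :
    dist (meshPoint δ p) (meshPoint δ q) ≤ 2 * δ * supDist p q := by
  rw [Complex.dist_eq]
  refine (Complex.norm_le_abs_re_add_abs_im _).trans ?_
  have h0 := abs_sub_le_supDist p q 0
  have h1 := abs_sub_le_supDist p q 1
  have h0' : |((p 0 : ℤ) : ℝ) - (q 0 : ℤ)| ≤ (supDist p q : ℝ) := by exact_mod_cast h0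
  have h1' : |((p 1 : ℤ) : ℝ) - (q 1 : ℤ)| ≤ (supDist p q : ℝ) := by exact_mod_cast h1
  simp only [Complex.sub_re, Complex.sub_im, meshPoint_re, meshPoint_im, ← mul_sub, abs_mul,
    abs_of_nonneg hδ]
  nlinarith

/-- Lower bound: `δ · supDist ≤ dist` of the mesh points. [folklore] -/
theorem le_dist_meshPoint (hδ : 0 ≤ δ) (p q : Site 2) :
    δ * supDist p q ≤ dist (meshPoint δ p) (meshPoint δ q) := by
  rw [Complex.dist_eq]
  have hre := Complex.abs_re_le_norm (meshPoint δ p - meshPoint δ q)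
  have him := Complex.abs_im_le_norm (meshPoint δ p - meshPoint δ q)
  simp only [Complex.sub_re, Complex.sub_im, meshPoint_re, meshPoint_im, ← mul_sub, abs_mul,
    abs_of_nonneg hδ] at hre him
  have : (supDist p q : ℝ) = max |((p 0 : ℤ) : ℝ) - (q 0 : ℤ)| |((p 1 : ℤ) : ℝ) - (q 1 : ℤ)| := by
    simp only [supDist]; push_cast; rfl
  rw [this]
  rcases le_total |((p 0 : ℤ) : ℝ) - (q 0 : ℤ)| |((p 1 : ℤ) : ℝ) - (q 1 : ℤ)| with h | h
  · rw [max_eq_right h]; exact him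
  · rw [max_eq_left h]; exact hre

/-- Consecutive mesh points of a SAW (and the clamped last one) are within `2δ`. [folklore] -/
theorem dist_meshPoint_getVert_succ_le (hδ : 0 ≤ δ) (γ : DomainSAW Ω δ u v) (t : ℕ) :
    dist (meshPoint δ (γ.walk.getVert t)) (meshPoint δ (γ.walk.getVert (t + 1))) ≤ 2 * δ := by
  rcases lt_or_ge t γ.walk.length with ht | ht
  · calc _ ≤ 2 * δ * supDist (γ.walk.getVert t) (γ.walk.getVert (t + 1)) :=
          dist_meshPoint_le hδ _ _
      _ ≤ 2 * δ * 1 := by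
          refine mul_le_mul_of_nonneg_left ?_ (by positivity)
          exact_mod_cast supDist_getVert_succ_le γ ht
      _ = 2 * δ := mul_one _
  · rw [γ.walk.getVert_of_length_le ht, γ.walk.getVert_of_length_le (by omega), dist_self]
    positivity

/-- **The polyline stays within `2δ` of its current vertex**. [folklore] -/
theorem dist_toCurve_getVert_le (hδ : 0 ≤ δ) (γ : DomainSAW Ω δ u v) (t : I) :
    dist (γ.walk.toCurve (meshPoint δ) t)
      (meshPoint δ (γ.walk.getVert (pieceIdx γ.walk.support.tail t))) ≤ 2 * δ := by
  set A := meshPoint δ (γ.walk.getVert (pieceIdx γ.walk.support.tail t))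
  set B := meshPoint δ (γ.walk.getVert (pieceIdx γ.walk.support.tail t + 1))
  have hseg := toCurve_mem_segment (meshPoint δ) γ.walk t
  have hsub : segment ℝ A B ⊆ Metric.closedBall A (2 * δ) :=
    (convex_closedBall A (2 * δ)).segment_subset (Metric.mem_closedBall_self (by positivity))
      (Metric.mem_closedBall.2 (by rw [dist_comm]; exact dist_meshPoint_getVert_succ_le hδ γ _))
  exact Metric.mem_closedBall.1 (hsub hseg)

end Summit.CriticalPhenomena.SAWScalingLimit.Theorems.TPToTraversalBound.Radial

end
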